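import Mathlib.Topology.ContinuousMap.SecondCountableSpace
import Mathlib.Topology.Metrizable.ContinuousMap
import Mathlib.MeasureTheory.Constructions.BorelSpace.Metric
import Mathlib.MeasureTheory.Constructions.BorelSpace.Order
import Mathlib.MeasureTheory.Constructions.Projective
import HarnessLib

/-!
# The Borel σ-algebra of the path space `C(α, β)` is generated by the evaluations

For a second countable locally compact space `α` (e.g. `ℝ≥0`, `[0, 1]`, `ℝ`) and a second
countable (pseudo)metric space `β` (e.g. `ℝ`, `ℂ`), the space `C(α, β)` of continuous maps with
the compact-open topology (= topology of locally uniform convergence, Mathlib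
`ContinuousMap.compactOpen`, `ContinuousMap.tendsto_iff_tendstoLocallyUniformly`) is second
countable and metrizable (Mathlib), and we prove:

* `Literature.Probability.Process.borel_continuousMap_eq_iSup_comap_eval` — its Borel σ-algebra is
  the σ-algebra generated by the evaluation maps `f ↦ f a`, `a : α`;
* `Literature.Probability.Process.measurable_continuousMap_of_eval` — hence a map `Φ : Ω → C(α, β)`
  is Borel measurable as soon as every `ω ↦ Φ ω a` is measurable (a continuous-path process IS
  a random element of path space);
* `Literature.Probability.Process.measure_continuousMap_ext_of_fdd` — and a finite Borel measure on
  `C(α, β)` is determined by its finite-dimensional distributions.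

These are the standard facts making "the law of a continuous process on `C([0, ∞))`"
meaningful (Billingsley, *Convergence of Probability Measures* (2nd ed. 1999), Example 1.3:
for `C[0, 1]` the finite-dimensional sets form a π-system `𝒞_f` with `σ(𝒞_f) = 𝒞`, the Borel
σ-field; and §7, *Random Functions*: "`X` is a random function if and only if each `X_t` is a
random variable"; the same argument on every `C[0, m]` gives `C[0, ∞)`). Here the domain is a
general second countable locally compact `α`, and the key step is that a sub-basic set
`{f | f(K) ⊆ U}` (`K` compact, `U` open) of the compact-open topology is a countable union over
`n` of countable intersections over a dense sequence `a ∈ K` of the evaluation-measurable sets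
`{f | dist(f a, Uᶜ) ≥ 1/(n+1)}` (`measurableSet_setOf_mapsTo`).

## References

* P. Billingsley, *Convergence of Probability Measures*, 2nd ed., Wiley (1999), §7.
* I. Karatzas, S. Shreve, *Brownian Motion and Stochastic Calculus*, 2nd ed. (1991), §2.4.
-/

noncomputable section

open Set Filter Topology Metric MeasureTheory TopologicalSpace

namespace Literature.Probability.Process

variable {α β : Type*} [TopologicalSpace α] [PseudoMetricSpace β] {mβ : MeasurableSpace β}

/-- Every evaluation `f ↦ f a` is measurable for the **evaluation σ-algebra**
`⨆ a, mβ.comap (f ↦ f a)` on `C(α, β)` (the smallest σ-algebra making all evaluations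
measurable; Billingsley (1999), Example 1.3, the class `𝒞_f`). [folklore] -/
theorem measurable_eval_iSup_comap (a : α) :
    Measurable[⨆ a : α, mβ.comap fun f : C(α, β) ↦ f a, mβ] fun f : C(α, β) ↦ f a :=
  measurable_iff_comap_le.2 (le_iSup (fun a : α ↦ mβ.comap fun f : C(α, β) ↦ f a) a)

/-- The evaluation σ-algebra is the pull-back of the product σ-algebra on `α → β` under the
(injective) coercion `f ↦ ⇑f`. [folklore] -/
theorem iSup_comap_eval_eq_comap_pi :
    (⨆ a : α, mβ.comap fun f : C(α, β) ↦ f a) =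
      MeasurableSpace.pi.comap fun (f : C(α, β)) (a : α) ↦ f a := by
  rw [MeasurableSpace.pi, MeasurableSpace.comap_iSup]
  simp only [MeasurableSpace.comap_comp]
  rfl

/-- **A sub-basic compact-open set is evaluation-measurable**: for `K ⊆ α` compact and `U ⊆ β`
open (and `α` second countable, so that `K` has a dense sequence), `{f | f(K) ⊆ U}` belongs to the
evaluation σ-algebra, being `⋃ₙ ⋂_{a ∈ D} {f | 1/(n+1) ≤ dist(f a, Uᶜ)}` for a countable dense
`D ⊆ K` (Billingsley (1999), Example 1.3, writes closed balls of `C[0, 1]` as countable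
intersections over rational times). [cite: Billingsley1999, Example 1.3] -/
theorem measurableSet_setOf_mapsTo [OpensMeasurableSpace β] [SecondCountableTopology α]
    {K : Set α} (hK : IsCompact K)
    {U : Set β} (hU : IsOpen U) :
    MeasurableSet[⨆ a : α, mβ.comap fun f : C(α, β) ↦ f a] {f : C(α, β) | MapsTo f K U} := by
  letI : MeasurableSpace C(α, β) := ⨆ a : α, mβ.comap fun f : C(α, β) ↦ f a
  have heval : ∀ a : α, Measurable fun f : C(α, β) ↦ f a := measurable_eval_iSup_comap
  rcases eq_or_ne U univ with rfl | hUne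
  · have : {f : C(α, β) | MapsTo f K univ} = univ := eq_univ_of_forall fun f ↦ mapsTo_univ f K
    rw [this]
    exact MeasurableSet.univ
  have hUc : (Uᶜ : Set β).Nonempty := nonempty_compl.2 hUne
  -- a countable dense subset `D` of `K`
  obtain ⟨D₀, hD₀c, hD₀d⟩ := TopologicalSpace.exists_countable_dense K
  set D : Set α := Subtype.val '' D₀ with hD
  have hDK : D ⊆ K := Subtype.coe_image_subset K D₀
  have hKD : K ⊆ closure D := Subtype.dense_iff.1 hD₀d
  have hDc : D.Countable := hD₀c.image _
  -- the representation
  have hrep : {f : C(α, β) | MapsTo f K U} =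
      ⋃ n : ℕ, ⋂ a ∈ D, {f : C(α, β) | 1 / ((n : ℝ) + 1) ≤ infDist (f a) Uᶜ} := by
    ext f
    simp only [mem_setOf_eq, mem_iUnion, mem_iInter]
    constructor
    · intro hf
      obtain ⟨δ, hδ, hcth⟩ :=
        (hK.image f.continuous).exists_cthickening_subset_open hU (mapsTo_iff_image_subset.1 hf)
      obtain ⟨n, hn⟩ := exists_nat_one_div_lt hδ
      refine ⟨n, fun a ha ↦ ?_⟩
      by_contra hlt
      rw [not_le] at hlt
      obtain ⟨u, hu, hdist⟩ := (infDist_lt_iff hUc).1 (hlt.trans hn)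
      refine hu (hcth (thickening_subset_cthickening δ _ ?_))
      exact mem_thickening_iff.2 ⟨f a, ⟨a, hDK ha, rfl⟩, by rwa [dist_comm]⟩
    · rintro ⟨n, hn⟩ a ha
      have hclosed : IsClosed {x : α | 1 / ((n : ℝ) + 1) ≤ infDist (f x) Uᶜ} :=
        isClosed_le continuous_const ((continuous_infDist_pt _).comp f.continuous)
      have ha' : 1 / ((n : ℝ) + 1) ≤ infDist (f a) Uᶜ :=
        (hclosed.closure_subset_iff.2 (fun x hx ↦ hn x hx)) (hKD ha)
      have hpos : infDist (f a) Uᶜ ≠ 0 := (lt_of_lt_of_le (by positivity) ha').ne'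
      have hnot : f a ∉ closure Uᶜ := fun h ↦ hpos ((mem_closure_iff_infDist_zero hUc).1 h)
      rw [hU.isClosed_compl.closure_eq] at hnot
      exact not_notMem.1 hnot
  rw [hrep]
  exact MeasurableSet.iUnion fun n ↦ MeasurableSet.biInter hDc fun a _ ↦
    measurableSet_le measurable_const ((continuous_infDist_pt _).measurable.comp (heval a))

variable [BorelSpace β] [SecondCountableTopology α] [LocallyCompactSpace α] [SecondCountableTopology β]

/-- **The Borel σ-algebra of `C(α, β)` (compact-open topology) is generated by the evaluation
maps**, for `α` second countable locally compact and `β` second countable (pseudo)metric: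
`C(α, β)` is then second countable (Mathlib), so its Borel σ-algebra is generated by the
compact-open sub-basis, each member of which is evaluation-measurable
(`measurableSet_setOf_mapsTo`); conversely evaluations are continuous. Billingsley (1999),
Example 1.3 (`σ(𝒞_f) = 𝒞` for `C[0, 1]`). [cite: Billingsley1999, Example 1.3] -/
theorem borel_continuousMap_eq_iSup_comap_eval :
    borel C(α, β) = ⨆ a : α, mβ.comap fun f : C(α, β) ↦ f a := by
  refine le_antisymm ?_ (iSup_le fun a ↦ measurable_iff_comap_le.1 ?_)
  · rw [borel_eq_generateFrom_of_subbasis (ContinuousMap.compactOpen_eq (X := α) (Y := β))]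
    refine MeasurableSpace.generateFrom_le ?_
    rintro _ ⟨K, hK, U, hU, rfl⟩
    exact measurableSet_setOf_mapsTo hK hU
  · borelize β
    exact (continuous_eval_const a).borel_measurable

/-- **A continuous-path process is a random element of path space**: `Φ : Ω → C(α, β)` is Borel
measurable as soon as each `ω ↦ Φ ω a` is measurable. Billingsley (1999), §7, Random Functions
("`X` is a random function if and only if each `X_t` is a random variable").
[cite: Billingsley1999, §7] -/
theorem measurable_continuousMap_of_eval {Ω : Type*} [MeasurableSpace Ω] {Φ : Ω → C(α, β)}
    (h : ∀ a, Measurable fun ω ↦ Φ ω a) : Measurable[_, borel C(α, β)] Φ := by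
  rw [borel_continuousMap_eq_iSup_comap_eval]
  refine measurable_iff_comap_le.2 ?_
  rw [MeasurableSpace.comap_iSup]
  exact iSup_le fun a ↦ by
    rw [MeasurableSpace.comap_comp]
    exact measurable_iff_comap_le.1 (h a)

/-- The coercion `C(α, β) → (α → β)` is measurable from the Borel σ-algebra to the product
σ-algebra. [folklore] -/
theorem measurable_coeFn_continuousMap :
    Measurable[borel C(α, β), MeasurableSpace.pi] fun (f : C(α, β)) (a : α) ↦ f a := by
  rw [borel_continuousMap_eq_iSup_comap_eval, iSup_comap_eval_eq_comap_pi]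
  exact comap_measurable _

/-- **A finite Borel measure on `C(α, β)` is determined by its finite-dimensional
distributions**: if `μ.map (f ↦ (f i)_{i ∈ I}) = ν.map (f ↦ (f i)_{i ∈ I})` for every finite
`I ⊆ α`, then `μ = ν`. (Both push-forwards to `α → β` are projective limits of the same finite
family, hence equal by Mathlib's `IsProjectiveLimit.unique`; and the Borel σ-algebra is the
pull-back of the product σ-algebra.) Billingsley (1999), Example 1.3 (`𝒞_f` is a separating
class) and §7, Random Functions (the finite-dimensional distributions of `P = P X⁻¹`).
[cite: Billingsley1999, Example 1.3] -/
theorem measure_continuousMap_ext_of_fdd {m : MeasurableSpace C(α, β)} [BorelSpace C(α, β)]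
    {μ ν : Measure C(α, β)} [IsFiniteMeasure μ]
    (h : ∀ I : Finset α, μ.map (fun (f : C(α, β)) (i : I) ↦ f i) =
      ν.map (fun (f : C(α, β)) (i : I) ↦ f i)) : μ = ν := by
  borelize C(α, β)
  set ρ : C(α, β) → (α → β) := fun f a ↦ f a with hρ
  have hρm : Measurable ρ := measurable_coeFn_continuousMap
  have hres : ∀ I : Finset α, Measurable (I.restrict (π := fun _ : α ↦ β)) := fun I ↦
    Finset.measurable_restrict I
  -- both push-forwards are projective limits of the same family
  set P : ∀ I : Finset α, Measure (∀ i : I, (fun _ : α ↦ β) i) :=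
    fun I ↦ μ.map (fun (f : C(α, β)) (i : I) ↦ f i) with hP
  haveI : ∀ I, IsFiniteMeasure (P I) := fun I ↦ Measure.isFiniteMeasure_map _ _
  have hμ : IsProjectiveLimit (μ.map ρ) P := fun I ↦ by
    rw [Measure.map_map (hres I) hρm]
    rfl
  have hν : IsProjectiveLimit (ν.map ρ) P := fun I ↦ by
    rw [Measure.map_map (hres I) hρm]
    change _ = μ.map (fun (f : C(α, β)) (i : I) ↦ f i)
    rw [h I]
    rfl
  have hmaps : μ.map ρ = ν.map ρ := hμ.unique hν
  ext s hs
  have hs' : MeasurableSet[MeasurableSpace.pi.comap ρ] s := by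
    rw [← iSup_comap_eval_eq_comap_pi, ← borel_continuousMap_eq_iSup_comap_eval]
    exact hs
  obtain ⟨t, ht, rfl⟩ := MeasurableSpace.measurableSet_comap.1 hs'
  rw [← Measure.map_apply hρm ht, ← Measure.map_apply hρm ht, hmaps]

end Literature.Probability.Process
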